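import Literature.AlgebraicGeometry.Hyperkaehler.K3HilbertKummerLatticePolarisationOrbits
import Literature.Topology.FourManifolds.LatticeFormsPolarisationTypesOrbitNumberGeneral
import Literature.Topology.FourManifolds.LatticeFormsPolarisationStabiliserQuotientGeneral
import HarnessLib

/-!
# The number of polarisation types of divisor `f` for a GENERAL `w` in the `K3^{[n]}` lattice `Λ_n = Λ_{K3} ⊕ ⟨−2(n−1)⟩`
# and in the `Kumⁿ` lattice `Λ_n = 3U ⊕ ⟨−2(n+1)⟩`: `N · φ(f₁) = φ(f) · 2^{ρ(f₁)}` resp. `· 2^{ρ(f₁/2)}`,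
# i.e. `N = w₊(f₁)φ(w₋(f₁)) · 2^{ρ}`, `w = (f, 2t/f)`, `f = wf₁`
# (Gritsenko–Hulek–Sankaran, *Compositio Math.* 146 (2010), §4 Prop. 4.6 (i)–(iii) for every `w`, (iv) last sentence, Remark 4.15)

Layer `Literature/AlgebraicGeometry/Hyperkaehler`. Written for lane `lit-hodgefound` (Track 2 foundations; prover seat
`lit-hodgefound-p18`, gen 45, row g45-#2). THEOREMS ONLY — no definition, no named fact, no instance, no notation.

Sequel of `K3HilbertKummerLatticePolarisationOrbits.lean` (rows g44-#2…#14, in particular §3: the orbit numbers `2^{ρ(f)}`,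
`2^{ρ(f/2)}` under `w = 1`) and of `Literature/Topology/FourManifolds/LatticeFormsPolarisationTypesOrbitNumberGeneral.lean`
(row g45-#1: Prop. 4.6 (i)–(iii) for every `w` in the abstract lattice `B₀ ⊕ ⟨−2t⟩`), at the two lattices of record
`Matrix.toBilin' (k3HilbertGram n)` (`t = n − 1`, `n ≥ 2`) and `Matrix.toBilin' (kumGram n)` (`t = n + 1`), through the
orbit ↔ admissible-class bijections `k3Hilbert_natCard_quot_stable_isometryEquiv_of_divisor` /
`kum_natCard_quot_stable_isometryEquiv_of_divisor` (rows g43-#4, g43-#6).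

## Source, verbatim (GHS, Compositio Math. 146 (2010), arXiv numbering §4, held text `paper:arxiv-0802.2078` pp. 10–11, 13)

"**Proposition 4.6.** Let `h_d ∈ L_{2t}` be primitive of length `2d > 0` and `div(h_d) = f`. We put `g = (2t/f, 2d/f)`,
`w = (g, f)`, `g = wg₁`, `f = wf₁`. […] (i) If `g₁` is even, then […] the number of `Õ(L_{2t})`-orbits of `h_d` with fixed `f`
(if at least one `h_d` exists) is equal to `w₊(f₁)φ(w₋(f₁)) · 2^{ρ(f₁)}`, where `w = w₊(f₁)w₋(f₁)` and `w₊(f₁)` is the product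
of all powers of primes dividing `(w, f₁)`, `ρ(n)` is the number of prime factors of `n` and `φ(n)` is the Euler function.
(ii) If `g₁` is odd, and `f₁` is even or `f₁` and `d₁` are both odd, then […] The number of `Õ(L_{2t})`-orbits of such `h_d` is
equal to `w₊(f₁)φ(w₋(f₁)) · 2^{ρ(f₁/2)}` if `f₁ ≡ 0 mod 2` and to `w₊(f₁)φ(w₋(f₁)) · 2^{ρ(f₁)}` if `f₁ ≡ d₁ ≡ 1 mod 2`. (iii) If
`g₁` and `f₁` are both odd and `d₁` is even, then […] The number of `Õ(L_{2t})`-orbits of such `h_d` is equal to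
`w₊(f₁)φ(w₋(f₁)) · 2^{ρ(f₁)}`. (iv) […] `B = (−2b, c·2t/f; c·2t/f, −2t)`. […] The greatest common divisor of the elements of `B`
is equal to `g₁(2b/g₁, w)`." (pp. 10–11) "**Remark 4.15.** […] Since the classification of polarisation types in this section
depends only on the discriminant group it immediately gives an identical classification for polarisations of deformations of
generalised Kummer varieties." (p. 13)

## Reading notes

* As in row g45-#1: for types that occur `w = ((2t/f, 2d/f), f) = (f, 2t/f)`; with `f = wf₁`, `2t/f = wT₁`, `(f₁, T₁) = 1`
  the three printed cases collapse to the parity of `f₁`, and the count is stated division-free as `N · φ(f₁) = φ(f) · 2^ρ`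
  (data form), in the printed product form `N = w₊(f₁)φ(w₋(f₁)) · 2^ρ` (`w₊ = ∏_{p ∣ w, p ∣ f₁} p^{v_p(w)}`,
  `w₋ = ∏_{p ∣ w, p ∤ f₁} p^{v_p(w)}`), and in closed form with `f₁ = f/(f, 2t/f)`. "If at least one `h_d` exists" is the
  hypothesis `hex`; the existence criteria by quadratic residues are not restated.
* §3 evaluates two small types with `w > 1`: `t = 8` (`K3^{[9]}`, `Kum⁷`), `f = 4` (`w = 4`, `f₁ = 1`): two `Õ`-orbits; and
  `t = 9` (`K3^{[10]}`, `Kum⁸`), `f = 3` (`w = 3`, `f₁ = 1`): two `Õ`-orbits — against `2^{ρ(f/2)} = 2` resp. `2^{ρ(f)} = 2`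
  that the `w = 1` formula would give only for `(f, 2t/f) = 1`, which fails here; the numbers agree by coincidence of small
  values (`φ(4) = φ(3) = 2`), the point being that §3 of the g44 file does not apply to these types while this file does.

## Contents (all proved)

* §1 `K3^{[n]}` (`n ≥ 2`, `t = n − 1`): `k3Hilbert_w_eq_gcd_of_divisor`;
  **`k3Hilbert_natCard_quot_stable_isometryEquiv_of_divisor_mul_totient_of_odd`** / **`_of_even`** (data form),
  **`k3Hilbert_natCard_quot_stable_isometryEquiv_of_divisor_eq_wPlus_mul_of_odd`** / **`_of_even`** (printed form),
  `k3Hilbert_natCard_quot_stable_isometryEquiv_of_divisor_mul_totient_div_gcd_of_odd` / `_of_even` (closed form),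
  `k3Hilbert_gcd_entries_of_divisor` ((iv): `gcd(2b, a, 2t) = g₁ · (2b/g₁, w)`).
* §2 `Kumⁿ` (`t = n + 1`): the same with `kum_`.
* §3 examples: `k3HilbertNine_natCard_quot_stable_isometryEquiv_of_divisor_four`, `kumSeven_…_four` (`t = 8`, `f = 4`: two
  orbits), `k3HilbertTen_natCard_quot_stable_isometryEquiv_of_divisor_three`, `kumEight_…_three` (`t = 9`, `f = 3`: two orbits).
* §4 (appended, row g45-#4; sequel of `Literature/Topology/FourManifolds/LatticeFormsPolarisationStabiliserQuotientGeneral.lean`,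
  row g45-#3) **Prop. 4.12 (ii) for EVERY divisor in `Λ_n`: `|O(Λ_n, h)/Õ(Λ_n, h)| = 2^{#{p ∣ t/f : p ∤ f}}` (`f` odd) ∕
  `2^{#{p ∣ t/m : p ∤ m}}` (`f = 2m`)**, no `w` hypothesis (`K3^{[n]}`: `t = n − 1`, `n ≥ 2`; `Kumⁿ`: `t = n + 1`):
  `k3Hilbert_natCard_quot_stabiliser_discriminantGroupCongr_eq_two_pow_filter_of_odd` ∕ `_of_even`, `kum_…`; and at `t = 8`
  (`K3^{[9]}`, `Kum⁷`): two classes for `div(h) = 2`, one class for `div(h) = 4` (`k3HilbertNine_…_two` ∕ `_four`, `kumSeven_…`).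

## References

* [GritsenkoHulekSankaran2010Symplectic] V. Gritsenko, K. Hulek, G. K. Sankaran, Moduli spaces of irreducible symplectic
  manifolds, Compositio Math. 146 (2010) 404–434 (arXiv:0802.2078): §4 Prop. 4.6 (i)–(iv), Prop. 4.12 (ii), Remark 4.15.
* [Markman2023GeneralizedKummers] E. Markman, The monodromy of generalized Kummer varieties …, JEMS 25 (2023) §1.1 (the
  `Kumⁿ` lattice `3U ⊕ ⟨−2(n+1)⟩`).
-/

noncomputable section

open Module Function Sum
open LinearMap (BilinForm)
open LinearMap.BilinForm
open Literature.Topology.FourManifolds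
open Literature.AlgebraicGeometry.Surfaces

namespace Literature.AlgebraicGeometry.Hyperkaehler

/-! ### §1 The `K3^{[n]}` lattice `Λ_n = Λ_{K3} ⊕ ⟨−2(n−1)⟩ = L_{2(n−1)}` (`n ≥ 2`, `t = n − 1`) -/

section K3Hilbert

variable {n : ℕ}

/-- The data of Prop. 4.6's proof for one primitive `h ∈ Λ_n` (`K3^{[n]}`, `n ≥ 2`) with `h² = 2d`, `f ∣ (h, Λ_n)`: `f ∣ 2(n−1)`,
`(f, h_δ) = 1`, `f² ∣ d + (n−1)h_δ²`. [cite: GritsenkoHulekSankaran2010Symplectic, §4 proof of Prop. 4.6, first paragraph] -/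
theorem k3Hilbert_divisor_data (hn : 2 ≤ n) {h : K3HilbertIndex → ℤ} {f d : ℤ}
    (hh : Matrix.toBilin' (k3HilbertGram n) h h = 2 * d) (hh0 : h ≠ 0)
    (hsat : ∀ (k : ℤ) (w : K3HilbertIndex → ℤ), k ≠ 0 → k • w ∈ ℤ ∙ h → w ∈ ℤ ∙ h)
    (hfh : ∀ z, f ∣ Matrix.toBilin' (k3HilbertGram n) h z) :
    f ∣ 2 * (n - 1 : ℕ) ∧ Int.gcd f (h (Sum.inr ())) = 1 ∧ f ^ 2 ∣ d + (n - 1 : ℕ) * h (Sum.inr ()) ^ 2 :=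
  ⟨k3Hilbert_dvd_two_mul_of_forall_dvd_of_primitive hn hh0 hsat hfh,
    k3Hilbert_gcd_eq_one_of_primitive_of_forall_dvd (by omega) hh0 hsat hfh,
    k3Hilbert_sq_dvd_add_mul_sq_of_forall_dvd (by omega) hh hfh⟩

/-- **For types that occur in `Λ_n` (`K3^{[n]}`, `n ≥ 2`, `t = n − 1`), `w = ((2t/f, 2d/f), f) = (f, 2t/f)`.**
[cite: GritsenkoHulekSankaran2010Symplectic, §4 Prop. 4.6 ("`g = (2t/f, 2d/f)`, `w = (g, f)`") and proof (display (c-eq))] -/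
theorem k3Hilbert_w_eq_gcd_of_divisor (hn : 2 ≤ n) {h : K3HilbertIndex → ℤ} {f d : ℤ} (hf0 : f ≠ 0)
    (hh : Matrix.toBilin' (k3HilbertGram n) h h = 2 * d) (hh0 : h ≠ 0)
    (hsat : ∀ (k : ℤ) (w : K3HilbertIndex → ℤ), k ≠ 0 → k • w ∈ ℤ ∙ h → w ∈ ℤ ∙ h)
    (hfh : ∀ z, f ∣ Matrix.toBilin' (k3HilbertGram n) h z) :
    Int.gcd (Int.gcd (2 * (n - 1 : ℕ) / f) (2 * d / f) : ℤ) f = Int.gcd f (2 * (n - 1 : ℕ) / f) := by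
  obtain ⟨hft, -, hd⟩ := k3Hilbert_divisor_data hn hh hh0 hsat hfh
  have hfd : f ∣ 2 * d := by rw [← hh]; exact hfh h
  exact gcd_gcd_eq_gcd_of_sq_dvd hf0 (Int.mul_ediv_cancel' hft).symm (Int.mul_ediv_cancel' hfd).symm hd

/-- **Prop. 4.6 (i)–(iii) for a general `w` in `Λ_n` (`K3^{[n]}`, `n ≥ 2`, `t = n − 1`), `f₁` odd**: the number `N` of
`Õ(Λ_n)`-orbits of primitive `h` with `h² = 2d`, `(h, Λ_n) = fℤ` (one exists) satisfies `N · φ(f₁) = φ(f) · 2^{ρ(f₁)}`, where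
`f = wf₁`, `2(n−1)/f = wT₁`, `(f₁, T₁) = 1` (`w = (f, 2t/f)`). [cite: GritsenkoHulekSankaran2010Symplectic, §4 Prop. 4.6 (i)–(iii)] -/
theorem k3Hilbert_natCard_quot_stable_isometryEquiv_of_divisor_mul_totient_of_odd (hn : 2 ≤ n) {d : ℤ} {f w f₁ T₁ : ℕ}
    (hf : f = w * f₁) (hT : 2 * (n - 1) = f * (w * T₁)) (hcop : Nat.Coprime f₁ T₁) (hodd : Odd f₁)
    (hex : ∃ h h' : K3HilbertIndex → ℤ, Matrix.toBilin' (k3HilbertGram n) h h = 2 * d ∧ h ≠ 0 ∧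
      (∀ (k : ℤ) (w : K3HilbertIndex → ℤ), k ≠ 0 → k • w ∈ ℤ ∙ h → w ∈ ℤ ∙ h) ∧
      (∀ z, (f : ℤ) ∣ Matrix.toBilin' (k3HilbertGram n) h z) ∧ Matrix.toBilin' (k3HilbertGram n) h h' = f) :
    Nat.card (Quot fun r s : {r : K3HilbertIndex → ℤ // Matrix.toBilin' (k3HilbertGram n) r r = 2 * d ∧ r ≠ 0 ∧
        (∀ (k : ℤ) (w : K3HilbertIndex → ℤ), k ≠ 0 → k • w ∈ ℤ ∙ r → w ∈ ℤ ∙ r) ∧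
        (∀ z, (f : ℤ) ∣ Matrix.toBilin' (k3HilbertGram n) r z) ∧ ∃ r', Matrix.toBilin' (k3HilbertGram n) r r' = f} ↦
      ∃ g : (Matrix.toBilin' (k3HilbertGram n)).IsometryEquiv (Matrix.toBilin' (k3HilbertGram n)),
        g.discriminantGroupCongr = LinearEquiv.refl ℤ _ ∧ g r.1 = s.1) * Nat.totient f₁ = Nat.totient f * 2 ^ f₁.primeFactors.card := by
  obtain ⟨h, h', hh, hh0, hsat, hfh, hh'⟩ := hex
  obtain ⟨hft, hc, hd⟩ := k3Hilbert_divisor_data hn hh hh0 hsat hfh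
  have hf0 : f ≠ 0 := by rintro rfl; rw [zero_mul] at hT; omega
  rw [k3Hilbert_natCard_quot_stable_isometryEquiv_of_divisor hn d (Nat.pos_of_ne_zero hf0) hft]
  exact natCard_admissible_mul_totient_of_odd hf0 hf hT hcop hodd hc hd

/-- **Prop. 4.6 (ii) for a general `w` in `Λ_n` (`K3^{[n]}`, `n ≥ 2`), `f₁ = 2m` even**: `N · φ(2m) = φ(f) · 2^{ρ(m)}` for the
number `N` of `Õ(Λ_n)`-orbits of primitive `h` with `h² = 2d`, `(h, Λ_n) = fℤ` (one exists; `f = w·2m`, `2(n−1)/f = wT₁`,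
`(2m, T₁) = 1`). [cite: GritsenkoHulekSankaran2010Symplectic, §4 Prop. 4.6 (ii)] -/
theorem k3Hilbert_natCard_quot_stable_isometryEquiv_of_divisor_mul_totient_of_even (hn : 2 ≤ n) {d : ℤ} {f w m T₁ : ℕ}
    (hm : 0 < m) (hf : f = w * (2 * m)) (hT : 2 * (n - 1) = f * (w * T₁)) (hcop : Nat.Coprime (2 * m) T₁)
    (hex : ∃ h h' : K3HilbertIndex → ℤ, Matrix.toBilin' (k3HilbertGram n) h h = 2 * d ∧ h ≠ 0 ∧
      (∀ (k : ℤ) (w : K3HilbertIndex → ℤ), k ≠ 0 → k • w ∈ ℤ ∙ h → w ∈ ℤ ∙ h) ∧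
      (∀ z, (f : ℤ) ∣ Matrix.toBilin' (k3HilbertGram n) h z) ∧ Matrix.toBilin' (k3HilbertGram n) h h' = f) :
    Nat.card (Quot fun r s : {r : K3HilbertIndex → ℤ // Matrix.toBilin' (k3HilbertGram n) r r = 2 * d ∧ r ≠ 0 ∧
        (∀ (k : ℤ) (w : K3HilbertIndex → ℤ), k ≠ 0 → k • w ∈ ℤ ∙ r → w ∈ ℤ ∙ r) ∧
        (∀ z, (f : ℤ) ∣ Matrix.toBilin' (k3HilbertGram n) r z) ∧ ∃ r', Matrix.toBilin' (k3HilbertGram n) r r' = f} ↦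
      ∃ g : (Matrix.toBilin' (k3HilbertGram n)).IsometryEquiv (Matrix.toBilin' (k3HilbertGram n)),
        g.discriminantGroupCongr = LinearEquiv.refl ℤ _ ∧ g r.1 = s.1) * Nat.totient (2 * m) = Nat.totient f * 2 ^ m.primeFactors.card := by
  obtain ⟨h, h', hh, hh0, hsat, hfh, hh'⟩ := hex
  obtain ⟨hft, hc, hd⟩ := k3Hilbert_divisor_data hn hh hh0 hsat hfh
  have hf0 : f ≠ 0 := by rintro rfl; rw [zero_mul] at hT; omega
  rw [k3Hilbert_natCard_quot_stable_isometryEquiv_of_divisor hn d (Nat.pos_of_ne_zero hf0) hft]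
  exact natCard_admissible_mul_totient_of_even hf0 hm hf hT hcop hc hd

/-- **Prop. 4.6 (i)–(iii) in the printed form in `Λ_n` (`K3^{[n]}`, `n ≥ 2`), `f₁` odd: the number of `Õ(Λ_n)`-orbits "is equal
to `w₊(f₁)φ(w₋(f₁)) · 2^{ρ(f₁)}`"** (`w₊ = ∏_{p ∣ w, p ∣ f₁} p^{v_p(w)}`, `w₋ = ∏_{p ∣ w, p ∤ f₁} p^{v_p(w)}`; `f = wf₁`,
`2(n−1)/f = wT₁`, `(f₁, T₁) = 1`). [cite: GritsenkoHulekSankaran2010Symplectic, §4 Prop. 4.6 (i)–(iii)] -/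
theorem k3Hilbert_natCard_quot_stable_isometryEquiv_of_divisor_eq_wPlus_mul_of_odd (hn : 2 ≤ n) {d : ℤ} {f w f₁ T₁ : ℕ}
    (hf : f = w * f₁) (hT : 2 * (n - 1) = f * (w * T₁)) (hcop : Nat.Coprime f₁ T₁) (hodd : Odd f₁)
    (hex : ∃ h h' : K3HilbertIndex → ℤ, Matrix.toBilin' (k3HilbertGram n) h h = 2 * d ∧ h ≠ 0 ∧
      (∀ (k : ℤ) (w : K3HilbertIndex → ℤ), k ≠ 0 → k • w ∈ ℤ ∙ h → w ∈ ℤ ∙ h) ∧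
      (∀ z, (f : ℤ) ∣ Matrix.toBilin' (k3HilbertGram n) h z) ∧ Matrix.toBilin' (k3HilbertGram n) h h' = f) :
    Nat.card (Quot fun r s : {r : K3HilbertIndex → ℤ // Matrix.toBilin' (k3HilbertGram n) r r = 2 * d ∧ r ≠ 0 ∧
        (∀ (k : ℤ) (w : K3HilbertIndex → ℤ), k ≠ 0 → k • w ∈ ℤ ∙ r → w ∈ ℤ ∙ r) ∧
        (∀ z, (f : ℤ) ∣ Matrix.toBilin' (k3HilbertGram n) r z) ∧ ∃ r', Matrix.toBilin' (k3HilbertGram n) r r' = f} ↦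
      ∃ g : (Matrix.toBilin' (k3HilbertGram n)).IsometryEquiv (Matrix.toBilin' (k3HilbertGram n)),
        g.discriminantGroupCongr = LinearEquiv.refl ℤ _ ∧ g r.1 = s.1) = (∏ p ∈ w.primeFactors with p ∣ f₁, p ^ w.factorization p) * Nat.totient (∏ p ∈ w.primeFactors with ¬p ∣ f₁, p ^ w.factorization p) * 2 ^ f₁.primeFactors.card := by
  obtain ⟨h, h', hh, hh0, hsat, hfh, hh'⟩ := hex
  obtain ⟨hft, hc, hd⟩ := k3Hilbert_divisor_data hn hh hh0 hsat hfh
  have hf0 : f ≠ 0 := by rintro rfl; rw [zero_mul] at hT; omega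
  rw [k3Hilbert_natCard_quot_stable_isometryEquiv_of_divisor hn d (Nat.pos_of_ne_zero hf0) hft]
  exact natCard_admissible_eq_wPlus_mul_totient_wMinus_mul_two_pow_of_odd hf0 hf hT hcop hodd hc hd

/-- **Prop. 4.6 (ii) in the printed form in `Λ_n` (`K3^{[n]}`, `n ≥ 2`), `f₁ = 2m` even: "`w₊(f₁)φ(w₋(f₁)) · 2^{ρ(f₁/2)}` if
`f₁ ≡ 0 mod 2`"**. [cite: GritsenkoHulekSankaran2010Symplectic, §4 Prop. 4.6 (ii)] -/
theorem k3Hilbert_natCard_quot_stable_isometryEquiv_of_divisor_eq_wPlus_mul_of_even (hn : 2 ≤ n) {d : ℤ} {f w m T₁ : ℕ}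
    (hm : 0 < m) (hf : f = w * (2 * m)) (hT : 2 * (n - 1) = f * (w * T₁)) (hcop : Nat.Coprime (2 * m) T₁)
    (hex : ∃ h h' : K3HilbertIndex → ℤ, Matrix.toBilin' (k3HilbertGram n) h h = 2 * d ∧ h ≠ 0 ∧
      (∀ (k : ℤ) (w : K3HilbertIndex → ℤ), k ≠ 0 → k • w ∈ ℤ ∙ h → w ∈ ℤ ∙ h) ∧
      (∀ z, (f : ℤ) ∣ Matrix.toBilin' (k3HilbertGram n) h z) ∧ Matrix.toBilin' (k3HilbertGram n) h h' = f) :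
    Nat.card (Quot fun r s : {r : K3HilbertIndex → ℤ // Matrix.toBilin' (k3HilbertGram n) r r = 2 * d ∧ r ≠ 0 ∧
        (∀ (k : ℤ) (w : K3HilbertIndex → ℤ), k ≠ 0 → k • w ∈ ℤ ∙ r → w ∈ ℤ ∙ r) ∧
        (∀ z, (f : ℤ) ∣ Matrix.toBilin' (k3HilbertGram n) r z) ∧ ∃ r', Matrix.toBilin' (k3HilbertGram n) r r' = f} ↦
      ∃ g : (Matrix.toBilin' (k3HilbertGram n)).IsometryEquiv (Matrix.toBilin' (k3HilbertGram n)),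
        g.discriminantGroupCongr = LinearEquiv.refl ℤ _ ∧ g r.1 = s.1) = (∏ p ∈ w.primeFactors with p ∣ 2 * m, p ^ w.factorization p) * Nat.totient (∏ p ∈ w.primeFactors with ¬p ∣ 2 * m, p ^ w.factorization p) * 2 ^ m.primeFactors.card := by
  obtain ⟨h, h', hh, hh0, hsat, hfh, hh'⟩ := hex
  obtain ⟨hft, hc, hd⟩ := k3Hilbert_divisor_data hn hh hh0 hsat hfh
  have hf0 : f ≠ 0 := by rintro rfl; rw [zero_mul] at hT; omega
  rw [k3Hilbert_natCard_quot_stable_isometryEquiv_of_divisor hn d (Nat.pos_of_ne_zero hf0) hft]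
  exact natCard_admissible_eq_wPlus_mul_totient_wMinus_mul_two_pow_of_even hf0 hm hf hT hcop hc hd

/-- **The orbit number in closed form in `Λ_n` (`K3^{[n]}`, `n ≥ 2`), `f/(f, 2(n−1)/f)` odd**: `N · φ(f₁) = φ(f) · 2^{ρ(f₁)}` with
`f₁ = f/(f, 2(n−1)/f)`. [cite: GritsenkoHulekSankaran2010Symplectic, §4 Prop. 4.6 (i)–(iii)] -/
theorem k3Hilbert_natCard_quot_stable_isometryEquiv_of_divisor_mul_totient_div_gcd_of_odd (hn : 2 ≤ n) {d : ℤ} {f : ℕ}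
    (hodd : Odd (f / Nat.gcd f (2 * (n - 1) / f)))
    (hex : ∃ h h' : K3HilbertIndex → ℤ, Matrix.toBilin' (k3HilbertGram n) h h = 2 * d ∧ h ≠ 0 ∧
      (∀ (k : ℤ) (w : K3HilbertIndex → ℤ), k ≠ 0 → k • w ∈ ℤ ∙ h → w ∈ ℤ ∙ h) ∧
      (∀ z, (f : ℤ) ∣ Matrix.toBilin' (k3HilbertGram n) h z) ∧ Matrix.toBilin' (k3HilbertGram n) h h' = f) :
    Nat.card (Quot fun r s : {r : K3HilbertIndex → ℤ // Matrix.toBilin' (k3HilbertGram n) r r = 2 * d ∧ r ≠ 0 ∧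
        (∀ (k : ℤ) (w : K3HilbertIndex → ℤ), k ≠ 0 → k • w ∈ ℤ ∙ r → w ∈ ℤ ∙ r) ∧
        (∀ z, (f : ℤ) ∣ Matrix.toBilin' (k3HilbertGram n) r z) ∧ ∃ r', Matrix.toBilin' (k3HilbertGram n) r r' = f} ↦
      ∃ g : (Matrix.toBilin' (k3HilbertGram n)).IsometryEquiv (Matrix.toBilin' (k3HilbertGram n)),
        g.discriminantGroupCongr = LinearEquiv.refl ℤ _ ∧ g r.1 = s.1) * Nat.totient (f / Nat.gcd f (2 * (n - 1) / f)) =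
      Nat.totient f * 2 ^ (f / Nat.gcd f (2 * (n - 1) / f)).primeFactors.card := by
  obtain ⟨h, h', hh, hh0, hsat, hfh, hh'⟩ := hex
  obtain ⟨hft, hc, hd⟩ := k3Hilbert_divisor_data hn hh hh0 hsat hfh
  have hf0 : (f : ℤ) ≠ 0 := by
    rintro hf
    rw [hf] at hfh
    exact hh0 ((nondegenerate_toBilin'_k3HilbertGram hn).1 h fun z ↦ zero_dvd_iff.1 (hfh z))
  have hf0' : f ≠ 0 := by exact_mod_cast hf0
  rw [k3Hilbert_natCard_quot_stable_isometryEquiv_of_divisor hn d (Nat.pos_of_ne_zero hf0') hft]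
  exact natCard_admissible_mul_totient_div_gcd_of_odd hf0' (by exact_mod_cast hft) hodd hc hd

/-- **The orbit number in closed form in `Λ_n` (`K3^{[n]}`, `n ≥ 2`), `f/(f, 2(n−1)/f)` even**: `N · φ(f₁) = φ(f) · 2^{ρ(f₁/2)}`
with `f₁ = f/(f, 2(n−1)/f)`. [cite: GritsenkoHulekSankaran2010Symplectic, §4 Prop. 4.6 (ii)] -/
theorem k3Hilbert_natCard_quot_stable_isometryEquiv_of_divisor_mul_totient_div_gcd_of_even (hn : 2 ≤ n) {d : ℤ} {f : ℕ}
    (heven : Even (f / Nat.gcd f (2 * (n - 1) / f)))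
    (hex : ∃ h h' : K3HilbertIndex → ℤ, Matrix.toBilin' (k3HilbertGram n) h h = 2 * d ∧ h ≠ 0 ∧
      (∀ (k : ℤ) (w : K3HilbertIndex → ℤ), k ≠ 0 → k • w ∈ ℤ ∙ h → w ∈ ℤ ∙ h) ∧
      (∀ z, (f : ℤ) ∣ Matrix.toBilin' (k3HilbertGram n) h z) ∧ Matrix.toBilin' (k3HilbertGram n) h h' = f) :
    Nat.card (Quot fun r s : {r : K3HilbertIndex → ℤ // Matrix.toBilin' (k3HilbertGram n) r r = 2 * d ∧ r ≠ 0 ∧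
        (∀ (k : ℤ) (w : K3HilbertIndex → ℤ), k ≠ 0 → k • w ∈ ℤ ∙ r → w ∈ ℤ ∙ r) ∧
        (∀ z, (f : ℤ) ∣ Matrix.toBilin' (k3HilbertGram n) r z) ∧ ∃ r', Matrix.toBilin' (k3HilbertGram n) r r' = f} ↦
      ∃ g : (Matrix.toBilin' (k3HilbertGram n)).IsometryEquiv (Matrix.toBilin' (k3HilbertGram n)),
        g.discriminantGroupCongr = LinearEquiv.refl ℤ _ ∧ g r.1 = s.1) * Nat.totient (f / Nat.gcd f (2 * (n - 1) / f)) =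
      Nat.totient f * 2 ^ (f / Nat.gcd f (2 * (n - 1) / f) / 2).primeFactors.card := by
  obtain ⟨h, h', hh, hh0, hsat, hfh, hh'⟩ := hex
  obtain ⟨hft, hc, hd⟩ := k3Hilbert_divisor_data hn hh hh0 hsat hfh
  have hf0 : (f : ℤ) ≠ 0 := by
    rintro hf
    rw [hf] at hfh
    exact hh0 ((nondegenerate_toBilin'_k3HilbertGram hn).1 h fun z ↦ zero_dvd_iff.1 (hfh z))
  have hf0' : f ≠ 0 := by exact_mod_cast hf0
  rw [k3Hilbert_natCard_quot_stable_isometryEquiv_of_divisor hn d (Nat.pos_of_ne_zero hf0') hft]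
  exact natCard_admissible_mul_totient_div_gcd_of_even hf0' (by exact_mod_cast hft) heven hc hd

/-- **Prop. 4.6 (iv), last sentence, in `Λ_n` (`K3^{[n]}`, `n ≥ 2`, `t = n − 1`)**: for a primitive `h` with `h² = 2d`,
`f ∣ (h, Λ_n)` (`f > 0`), `c = h_δ`, and `b`, `a` with `f²b = d + (n−1)c²`, `fa = 2(n−1)c` (so that `h^⊥ ≅ 2U ⊕ 2E₈(−1) ⊕ B`,
`B = (−2b, a; a, −2(n−1))`, `k3Hilbert_restrict_orthogonal_equivalent_of_divisor`): "The greatest common divisor of the elements of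
`B` is equal to `g₁(2b/g₁, w)`", `g = (2t/f, 2d/f) = wg₁`, `w = (g, f)`. [cite: GritsenkoHulekSankaran2010Symplectic, §4 Prop. 4.6 (iv)] -/
theorem k3Hilbert_gcd_entries_of_divisor (hn : 2 ≤ n) {h : K3HilbertIndex → ℤ} {f d b a : ℤ} (hf : 0 < f)
    (hh : Matrix.toBilin' (k3HilbertGram n) h h = 2 * d) (hh0 : h ≠ 0)
    (hsat : ∀ (k : ℤ) (w : K3HilbertIndex → ℤ), k ≠ 0 → k • w ∈ ℤ ∙ h → w ∈ ℤ ∙ h)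
    (hfh : ∀ z, f ∣ Matrix.toBilin' (k3HilbertGram n) h z)
    (hb : f ^ 2 * b = d + (n - 1 : ℕ) * h (Sum.inr ()) ^ 2) (ha : f * a = 2 * (n - 1 : ℕ) * h (Sum.inr ())) :
    Int.gcd (Int.gcd (2 * b) a) (2 * (n - 1 : ℕ)) =
      (Int.gcd (2 * (n - 1 : ℕ) / f) (2 * d / f) / Int.gcd (Int.gcd (2 * (n - 1 : ℕ) / f) (2 * d / f)) f) *
        Int.gcd (2 * b / (Int.gcd (2 * (n - 1 : ℕ) / f) (2 * d / f) /
          Int.gcd (Int.gcd (2 * (n - 1 : ℕ) / f) (2 * d / f)) f : ℕ))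
          (Int.gcd (Int.gcd (2 * (n - 1 : ℕ) / f) (2 * d / f)) f) := by
  obtain ⟨hft, hc, -⟩ := k3Hilbert_divisor_data hn hh hh0 hsat hfh
  have hfd : f ∣ 2 * d := by rw [← hh]; exact hfh h
  exact gcd_entries_generalDivisorGram (t := n - 1) (by omega) hf (Int.mul_ediv_cancel' hft).symm
    (Int.mul_ediv_cancel' hfd).symm hb ha hc

end K3Hilbert

/-! ### §2 The `Kumⁿ` lattice `Λ_n = 3U ⊕ ⟨−2(n+1)⟩` (all `n`, `t = n + 1`; Remark 4.15) -/

section Kum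

variable {n : ℕ}

/-- The data of Prop. 4.6's proof for one primitive `h ∈ Λ_n` (`Kumⁿ`) with `h² = 2d`, `f ∣ (h, Λ_n)`: `f ∣ 2(n+1)`,
`(f, h_ξ) = 1`, `f² ∣ d + (n+1)h_ξ²`. [cite: GritsenkoHulekSankaran2010Symplectic, §4 proof of Prop. 4.6, first paragraph, and Remark 4.15] -/
theorem kum_divisor_data {h : KumIndex → ℤ} {f d : ℤ}
    (hh : Matrix.toBilin' (kumGram n) h h = 2 * d) (hh0 : h ≠ 0)
    (hsat : ∀ (k : ℤ) (w : KumIndex → ℤ), k ≠ 0 → k • w ∈ ℤ ∙ h → w ∈ ℤ ∙ h)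
    (hfh : ∀ z, f ∣ Matrix.toBilin' (kumGram n) h z) :
    f ∣ 2 * (n + 1 : ℕ) ∧ Int.gcd f (h (inr ())) = 1 ∧ f ^ 2 ∣ d + (n + 1 : ℕ) * h (inr ()) ^ 2 :=
  ⟨kum_dvd_two_mul_of_forall_dvd_of_primitive hh0 hsat hfh, kum_gcd_eq_one_of_primitive_of_forall_dvd hh0 hsat hfh,
    kum_sq_dvd_add_mul_sq_of_forall_dvd hh hfh⟩

/-- **For types that occur in `Λ_n` (`Kumⁿ`, `t = n + 1`), `w = ((2t/f, 2d/f), f) = (f, 2t/f)`.**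
[cite: GritsenkoHulekSankaran2010Symplectic, §4 Prop. 4.6 and proof (display (c-eq)), Remark 4.15] -/
theorem kum_w_eq_gcd_of_divisor {h : KumIndex → ℤ} {f d : ℤ} (hf0 : f ≠ 0)
    (hh : Matrix.toBilin' (kumGram n) h h = 2 * d) (hh0 : h ≠ 0)
    (hsat : ∀ (k : ℤ) (w : KumIndex → ℤ), k ≠ 0 → k • w ∈ ℤ ∙ h → w ∈ ℤ ∙ h)
    (hfh : ∀ z, f ∣ Matrix.toBilin' (kumGram n) h z) :
    Int.gcd (Int.gcd (2 * (n + 1 : ℕ) / f) (2 * d / f) : ℤ) f = Int.gcd f (2 * (n + 1 : ℕ) / f) := by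
  obtain ⟨hft, -, hd⟩ := kum_divisor_data hh hh0 hsat hfh
  have hfd : f ∣ 2 * d := by rw [← hh]; exact hfh h
  exact gcd_gcd_eq_gcd_of_sq_dvd hf0 (Int.mul_ediv_cancel' hft).symm (Int.mul_ediv_cancel' hfd).symm hd

/-- **Prop. 4.6 (i)–(iii) for a general `w` in `Λ_n` (`Kumⁿ`, `t = n + 1`), `f₁` odd**: `N · φ(f₁) = φ(f) · 2^{ρ(f₁)}` for the
number `N` of `Õ(Λ_n)`-orbits of primitive `h` with `h² = 2d`, `(h, Λ_n) = fℤ` (one exists; `f = wf₁`, `2(n+1)/f = wT₁`,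
`(f₁, T₁) = 1`). [cite: GritsenkoHulekSankaran2010Symplectic, §4 Prop. 4.6 (i)–(iii) and Remark 4.15] -/
theorem kum_natCard_quot_stable_isometryEquiv_of_divisor_mul_totient_of_odd (n : ℕ) {d : ℤ} {f w f₁ T₁ : ℕ}
    (hf : f = w * f₁) (hT : 2 * (n + 1) = f * (w * T₁)) (hcop : Nat.Coprime f₁ T₁) (hodd : Odd f₁)
    (hex : ∃ h h' : KumIndex → ℤ, Matrix.toBilin' (kumGram n) h h = 2 * d ∧ h ≠ 0 ∧
      (∀ (k : ℤ) (w : KumIndex → ℤ), k ≠ 0 → k • w ∈ ℤ ∙ h → w ∈ ℤ ∙ h) ∧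
      (∀ z, (f : ℤ) ∣ Matrix.toBilin' (kumGram n) h z) ∧ Matrix.toBilin' (kumGram n) h h' = f) :
    Nat.card (Quot fun r s : {r : KumIndex → ℤ // Matrix.toBilin' (kumGram n) r r = 2 * d ∧ r ≠ 0 ∧
        (∀ (k : ℤ) (w : KumIndex → ℤ), k ≠ 0 → k • w ∈ ℤ ∙ r → w ∈ ℤ ∙ r) ∧
        (∀ z, (f : ℤ) ∣ Matrix.toBilin' (kumGram n) r z) ∧ ∃ r', Matrix.toBilin' (kumGram n) r r' = f} ↦
      ∃ g : (Matrix.toBilin' (kumGram n)).IsometryEquiv (Matrix.toBilin' (kumGram n)),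
        g.discriminantGroupCongr = LinearEquiv.refl ℤ _ ∧ g r.1 = s.1) * Nat.totient f₁ = Nat.totient f * 2 ^ f₁.primeFactors.card := by
  obtain ⟨h, h', hh, hh0, hsat, hfh, hh'⟩ := hex
  obtain ⟨hft, hc, hd⟩ := kum_divisor_data hh hh0 hsat hfh
  have hf0 : f ≠ 0 := by rintro rfl; rw [zero_mul] at hT; omega
  rw [kum_natCard_quot_stable_isometryEquiv_of_divisor n d (Nat.pos_of_ne_zero hf0) hft]
  exact natCard_admissible_mul_totient_of_odd hf0 hf hT hcop hodd hc hd

/-- **Prop. 4.6 (ii) for a general `w` in `Λ_n` (`Kumⁿ`), `f₁ = 2m` even**: `N · φ(2m) = φ(f) · 2^{ρ(m)}` (`f = w·2m`,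
`2(n+1)/f = wT₁`, `(2m, T₁) = 1`). [cite: GritsenkoHulekSankaran2010Symplectic, §4 Prop. 4.6 (ii) and Remark 4.15] -/
theorem kum_natCard_quot_stable_isometryEquiv_of_divisor_mul_totient_of_even (n : ℕ) {d : ℤ} {f w m T₁ : ℕ}
    (hm : 0 < m) (hf : f = w * (2 * m)) (hT : 2 * (n + 1) = f * (w * T₁)) (hcop : Nat.Coprime (2 * m) T₁)
    (hex : ∃ h h' : KumIndex → ℤ, Matrix.toBilin' (kumGram n) h h = 2 * d ∧ h ≠ 0 ∧
      (∀ (k : ℤ) (w : KumIndex → ℤ), k ≠ 0 → k • w ∈ ℤ ∙ h → w ∈ ℤ ∙ h) ∧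
      (∀ z, (f : ℤ) ∣ Matrix.toBilin' (kumGram n) h z) ∧ Matrix.toBilin' (kumGram n) h h' = f) :
    Nat.card (Quot fun r s : {r : KumIndex → ℤ // Matrix.toBilin' (kumGram n) r r = 2 * d ∧ r ≠ 0 ∧
        (∀ (k : ℤ) (w : KumIndex → ℤ), k ≠ 0 → k • w ∈ ℤ ∙ r → w ∈ ℤ ∙ r) ∧
        (∀ z, (f : ℤ) ∣ Matrix.toBilin' (kumGram n) r z) ∧ ∃ r', Matrix.toBilin' (kumGram n) r r' = f} ↦
      ∃ g : (Matrix.toBilin' (kumGram n)).IsometryEquiv (Matrix.toBilin' (kumGram n)),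
        g.discriminantGroupCongr = LinearEquiv.refl ℤ _ ∧ g r.1 = s.1) * Nat.totient (2 * m) = Nat.totient f * 2 ^ m.primeFactors.card := by
  obtain ⟨h, h', hh, hh0, hsat, hfh, hh'⟩ := hex
  obtain ⟨hft, hc, hd⟩ := kum_divisor_data hh hh0 hsat hfh
  have hf0 : f ≠ 0 := by rintro rfl; rw [zero_mul] at hT; omega
  rw [kum_natCard_quot_stable_isometryEquiv_of_divisor n d (Nat.pos_of_ne_zero hf0) hft]
  exact natCard_admissible_mul_totient_of_even hf0 hm hf hT hcop hc hd

/-- **Prop. 4.6 (i)–(iii) in the printed form in `Λ_n` (`Kumⁿ`), `f₁` odd: "`w₊(f₁)φ(w₋(f₁)) · 2^{ρ(f₁)}`"** (`f = wf₁`,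
`2(n+1)/f = wT₁`, `(f₁, T₁) = 1`). [cite: GritsenkoHulekSankaran2010Symplectic, §4 Prop. 4.6 (i)–(iii) and Remark 4.15] -/
theorem kum_natCard_quot_stable_isometryEquiv_of_divisor_eq_wPlus_mul_of_odd (n : ℕ) {d : ℤ} {f w f₁ T₁ : ℕ}
    (hf : f = w * f₁) (hT : 2 * (n + 1) = f * (w * T₁)) (hcop : Nat.Coprime f₁ T₁) (hodd : Odd f₁)
    (hex : ∃ h h' : KumIndex → ℤ, Matrix.toBilin' (kumGram n) h h = 2 * d ∧ h ≠ 0 ∧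
      (∀ (k : ℤ) (w : KumIndex → ℤ), k ≠ 0 → k • w ∈ ℤ ∙ h → w ∈ ℤ ∙ h) ∧
      (∀ z, (f : ℤ) ∣ Matrix.toBilin' (kumGram n) h z) ∧ Matrix.toBilin' (kumGram n) h h' = f) :
    Nat.card (Quot fun r s : {r : KumIndex → ℤ // Matrix.toBilin' (kumGram n) r r = 2 * d ∧ r ≠ 0 ∧
        (∀ (k : ℤ) (w : KumIndex → ℤ), k ≠ 0 → k • w ∈ ℤ ∙ r → w ∈ ℤ ∙ r) ∧
        (∀ z, (f : ℤ) ∣ Matrix.toBilin' (kumGram n) r z) ∧ ∃ r', Matrix.toBilin' (kumGram n) r r' = f} ↦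
      ∃ g : (Matrix.toBilin' (kumGram n)).IsometryEquiv (Matrix.toBilin' (kumGram n)),
        g.discriminantGroupCongr = LinearEquiv.refl ℤ _ ∧ g r.1 = s.1) = (∏ p ∈ w.primeFactors with p ∣ f₁, p ^ w.factorization p) * Nat.totient (∏ p ∈ w.primeFactors with ¬p ∣ f₁, p ^ w.factorization p) * 2 ^ f₁.primeFactors.card := by
  obtain ⟨h, h', hh, hh0, hsat, hfh, hh'⟩ := hex
  obtain ⟨hft, hc, hd⟩ := kum_divisor_data hh hh0 hsat hfh
  have hf0 : f ≠ 0 := by rintro rfl; rw [zero_mul] at hT; omega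
  rw [kum_natCard_quot_stable_isometryEquiv_of_divisor n d (Nat.pos_of_ne_zero hf0) hft]
  exact natCard_admissible_eq_wPlus_mul_totient_wMinus_mul_two_pow_of_odd hf0 hf hT hcop hodd hc hd

/-- **Prop. 4.6 (ii) in the printed form in `Λ_n` (`Kumⁿ`), `f₁ = 2m` even: "`w₊(f₁)φ(w₋(f₁)) · 2^{ρ(f₁/2)}`"**.
[cite: GritsenkoHulekSankaran2010Symplectic, §4 Prop. 4.6 (ii) and Remark 4.15] -/
theorem kum_natCard_quot_stable_isometryEquiv_of_divisor_eq_wPlus_mul_of_even (n : ℕ) {d : ℤ} {f w m T₁ : ℕ}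
    (hm : 0 < m) (hf : f = w * (2 * m)) (hT : 2 * (n + 1) = f * (w * T₁)) (hcop : Nat.Coprime (2 * m) T₁)
    (hex : ∃ h h' : KumIndex → ℤ, Matrix.toBilin' (kumGram n) h h = 2 * d ∧ h ≠ 0 ∧
      (∀ (k : ℤ) (w : KumIndex → ℤ), k ≠ 0 → k • w ∈ ℤ ∙ h → w ∈ ℤ ∙ h) ∧
      (∀ z, (f : ℤ) ∣ Matrix.toBilin' (kumGram n) h z) ∧ Matrix.toBilin' (kumGram n) h h' = f) :
    Nat.card (Quot fun r s : {r : KumIndex → ℤ // Matrix.toBilin' (kumGram n) r r = 2 * d ∧ r ≠ 0 ∧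
        (∀ (k : ℤ) (w : KumIndex → ℤ), k ≠ 0 → k • w ∈ ℤ ∙ r → w ∈ ℤ ∙ r) ∧
        (∀ z, (f : ℤ) ∣ Matrix.toBilin' (kumGram n) r z) ∧ ∃ r', Matrix.toBilin' (kumGram n) r r' = f} ↦
      ∃ g : (Matrix.toBilin' (kumGram n)).IsometryEquiv (Matrix.toBilin' (kumGram n)),
        g.discriminantGroupCongr = LinearEquiv.refl ℤ _ ∧ g r.1 = s.1) = (∏ p ∈ w.primeFactors with p ∣ 2 * m, p ^ w.factorization p) * Nat.totient (∏ p ∈ w.primeFactors with ¬p ∣ 2 * m, p ^ w.factorization p) * 2 ^ m.primeFactors.card := by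
  obtain ⟨h, h', hh, hh0, hsat, hfh, hh'⟩ := hex
  obtain ⟨hft, hc, hd⟩ := kum_divisor_data hh hh0 hsat hfh
  have hf0 : f ≠ 0 := by rintro rfl; rw [zero_mul] at hT; omega
  rw [kum_natCard_quot_stable_isometryEquiv_of_divisor n d (Nat.pos_of_ne_zero hf0) hft]
  exact natCard_admissible_eq_wPlus_mul_totient_wMinus_mul_two_pow_of_even hf0 hm hf hT hcop hc hd

/-- **The orbit number in closed form in `Λ_n` (`Kumⁿ`), `f/(f, 2(n+1)/f)` odd**: `N · φ(f₁) = φ(f) · 2^{ρ(f₁)}`,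
`f₁ = f/(f, 2(n+1)/f)`. [cite: GritsenkoHulekSankaran2010Symplectic, §4 Prop. 4.6 (i)–(iii) and Remark 4.15] -/
theorem kum_natCard_quot_stable_isometryEquiv_of_divisor_mul_totient_div_gcd_of_odd (n : ℕ) {d : ℤ} {f : ℕ}
    (hodd : Odd (f / Nat.gcd f (2 * (n + 1) / f)))
    (hex : ∃ h h' : KumIndex → ℤ, Matrix.toBilin' (kumGram n) h h = 2 * d ∧ h ≠ 0 ∧
      (∀ (k : ℤ) (w : KumIndex → ℤ), k ≠ 0 → k • w ∈ ℤ ∙ h → w ∈ ℤ ∙ h) ∧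
      (∀ z, (f : ℤ) ∣ Matrix.toBilin' (kumGram n) h z) ∧ Matrix.toBilin' (kumGram n) h h' = f) :
    Nat.card (Quot fun r s : {r : KumIndex → ℤ // Matrix.toBilin' (kumGram n) r r = 2 * d ∧ r ≠ 0 ∧
        (∀ (k : ℤ) (w : KumIndex → ℤ), k ≠ 0 → k • w ∈ ℤ ∙ r → w ∈ ℤ ∙ r) ∧
        (∀ z, (f : ℤ) ∣ Matrix.toBilin' (kumGram n) r z) ∧ ∃ r', Matrix.toBilin' (kumGram n) r r' = f} ↦
      ∃ g : (Matrix.toBilin' (kumGram n)).IsometryEquiv (Matrix.toBilin' (kumGram n)),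
        g.discriminantGroupCongr = LinearEquiv.refl ℤ _ ∧ g r.1 = s.1) * Nat.totient (f / Nat.gcd f (2 * (n + 1) / f)) =
      Nat.totient f * 2 ^ (f / Nat.gcd f (2 * (n + 1) / f)).primeFactors.card := by
  obtain ⟨h, h', hh, hh0, hsat, hfh, hh'⟩ := hex
  obtain ⟨hft, hc, hd⟩ := kum_divisor_data hh hh0 hsat hfh
  have hf0 : (f : ℤ) ≠ 0 := by
    rintro hf
    rw [hf] at hfh
    exact hh0 ((nondegenerate_toBilin'_kumGram n).1 h fun z ↦ zero_dvd_iff.1 (hfh z))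
  have hf0' : f ≠ 0 := by exact_mod_cast hf0
  rw [kum_natCard_quot_stable_isometryEquiv_of_divisor n d (Nat.pos_of_ne_zero hf0') hft]
  exact natCard_admissible_mul_totient_div_gcd_of_odd hf0' (by exact_mod_cast hft) hodd hc hd

/-- **The orbit number in closed form in `Λ_n` (`Kumⁿ`), `f/(f, 2(n+1)/f)` even**: `N · φ(f₁) = φ(f) · 2^{ρ(f₁/2)}`,
`f₁ = f/(f, 2(n+1)/f)`. [cite: GritsenkoHulekSankaran2010Symplectic, §4 Prop. 4.6 (ii) and Remark 4.15] -/
theorem kum_natCard_quot_stable_isometryEquiv_of_divisor_mul_totient_div_gcd_of_even (n : ℕ) {d : ℤ} {f : ℕ}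
    (heven : Even (f / Nat.gcd f (2 * (n + 1) / f)))
    (hex : ∃ h h' : KumIndex → ℤ, Matrix.toBilin' (kumGram n) h h = 2 * d ∧ h ≠ 0 ∧
      (∀ (k : ℤ) (w : KumIndex → ℤ), k ≠ 0 → k • w ∈ ℤ ∙ h → w ∈ ℤ ∙ h) ∧
      (∀ z, (f : ℤ) ∣ Matrix.toBilin' (kumGram n) h z) ∧ Matrix.toBilin' (kumGram n) h h' = f) :
    Nat.card (Quot fun r s : {r : KumIndex → ℤ // Matrix.toBilin' (kumGram n) r r = 2 * d ∧ r ≠ 0 ∧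
        (∀ (k : ℤ) (w : KumIndex → ℤ), k ≠ 0 → k • w ∈ ℤ ∙ r → w ∈ ℤ ∙ r) ∧
        (∀ z, (f : ℤ) ∣ Matrix.toBilin' (kumGram n) r z) ∧ ∃ r', Matrix.toBilin' (kumGram n) r r' = f} ↦
      ∃ g : (Matrix.toBilin' (kumGram n)).IsometryEquiv (Matrix.toBilin' (kumGram n)),
        g.discriminantGroupCongr = LinearEquiv.refl ℤ _ ∧ g r.1 = s.1) * Nat.totient (f / Nat.gcd f (2 * (n + 1) / f)) =
      Nat.totient f * 2 ^ (f / Nat.gcd f (2 * (n + 1) / f) / 2).primeFactors.card := by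
  obtain ⟨h, h', hh, hh0, hsat, hfh, hh'⟩ := hex
  obtain ⟨hft, hc, hd⟩ := kum_divisor_data hh hh0 hsat hfh
  have hf0 : (f : ℤ) ≠ 0 := by
    rintro hf
    rw [hf] at hfh
    exact hh0 ((nondegenerate_toBilin'_kumGram n).1 h fun z ↦ zero_dvd_iff.1 (hfh z))
  have hf0' : f ≠ 0 := by exact_mod_cast hf0
  rw [kum_natCard_quot_stable_isometryEquiv_of_divisor n d (Nat.pos_of_ne_zero hf0') hft]
  exact natCard_admissible_mul_totient_div_gcd_of_even hf0' (by exact_mod_cast hft) heven hc hd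

/-- **Prop. 4.6 (iv), last sentence, in `Λ_n` (`Kumⁿ`, `t = n + 1`)**: for a primitive `h` with `h² = 2d`, `f ∣ (h, Λ_n)`
(`f > 0`), `c = h_ξ`, and `b`, `a` with `f²b = d + (n+1)c²`, `fa = 2(n+1)c` (so that `h^⊥ ≅ 2U ⊕ B`, `B = (−2b, a; a, −2(n+1))`,
`kum_restrict_orthogonal_equivalent_of_divisor`): `gcd(2b, a, 2(n+1)) = g₁ · (2b/g₁, w)`, `g = (2t/f, 2d/f) = wg₁`, `w = (g, f)`.
[cite: GritsenkoHulekSankaran2010Symplectic, §4 Prop. 4.6 (iv) and Remark 4.15] -/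
theorem kum_gcd_entries_of_divisor {h : KumIndex → ℤ} {f d b a : ℤ} (hf : 0 < f)
    (hh : Matrix.toBilin' (kumGram n) h h = 2 * d) (hh0 : h ≠ 0)
    (hsat : ∀ (k : ℤ) (w : KumIndex → ℤ), k ≠ 0 → k • w ∈ ℤ ∙ h → w ∈ ℤ ∙ h)
    (hfh : ∀ z, f ∣ Matrix.toBilin' (kumGram n) h z)
    (hb : f ^ 2 * b = d + (n + 1 : ℕ) * h (inr ()) ^ 2) (ha : f * a = 2 * (n + 1 : ℕ) * h (inr ())) :
    Int.gcd (Int.gcd (2 * b) a) (2 * (n + 1 : ℕ)) =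
      (Int.gcd (2 * (n + 1 : ℕ) / f) (2 * d / f) / Int.gcd (Int.gcd (2 * (n + 1 : ℕ) / f) (2 * d / f)) f) *
        Int.gcd (2 * b / (Int.gcd (2 * (n + 1 : ℕ) / f) (2 * d / f) /
          Int.gcd (Int.gcd (2 * (n + 1 : ℕ) / f) (2 * d / f)) f : ℕ))
          (Int.gcd (Int.gcd (2 * (n + 1 : ℕ) / f) (2 * d / f)) f) := by
  obtain ⟨hft, hc, -⟩ := kum_divisor_data hh hh0 hsat hfh
  have hfd : f ∣ 2 * d := by rw [← hh]; exact hfh h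
  exact gcd_entries_generalDivisorGram (t := n + 1) (Nat.succ_pos n) hf (Int.mul_ediv_cancel' hft).symm
    (Int.mul_ediv_cancel' hfd).symm hb ha hc

end Kum

/-! ### §3 Two small types with `w > 1`: `t = 8`, `f = 4` and `t = 9`, `f = 3` — two `Õ`-orbits each -/

section Examples

/-- **`K3^{[9]}` (`t = 8`), `div(h) = 4`**: `w = (4, 16/4) = 4`, `f₁ = 1`, so the primitive `h ∈ Λ_9` with `h² = 2d`,
`(h, Λ_9) = 4ℤ` form exactly `φ(4)/φ(1) · 2^{ρ(1)} = 2` orbits under `Õ(Λ_9)`, as soon as one exists.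
[cite: GritsenkoHulekSankaran2010Symplectic, §4 Prop. 4.6 (i)–(iii)] -/
theorem k3HilbertNine_natCard_quot_stable_isometryEquiv_of_divisor_four {d : ℤ}
    (hex : ∃ h h' : K3HilbertIndex → ℤ, Matrix.toBilin' (k3HilbertGram 9) h h = 2 * d ∧ h ≠ 0 ∧
      (∀ (k : ℤ) (w : K3HilbertIndex → ℤ), k ≠ 0 → k • w ∈ ℤ ∙ h → w ∈ ℤ ∙ h) ∧
      (∀ z, ((4 : ℕ) : ℤ) ∣ Matrix.toBilin' (k3HilbertGram 9) h z) ∧ Matrix.toBilin' (k3HilbertGram 9) h h' = (4 : ℕ)) :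
    Nat.card (Quot fun r s : {r : K3HilbertIndex → ℤ // Matrix.toBilin' (k3HilbertGram 9) r r = 2 * d ∧ r ≠ 0 ∧
        (∀ (k : ℤ) (w : K3HilbertIndex → ℤ), k ≠ 0 → k • w ∈ ℤ ∙ r → w ∈ ℤ ∙ r) ∧
        (∀ z, ((4 : ℕ) : ℤ) ∣ Matrix.toBilin' (k3HilbertGram 9) r z) ∧ ∃ r', Matrix.toBilin' (k3HilbertGram 9) r r' = (4 : ℕ)} ↦
      ∃ g : (Matrix.toBilin' (k3HilbertGram 9)).IsometryEquiv (Matrix.toBilin' (k3HilbertGram 9)),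
        g.discriminantGroupCongr = LinearEquiv.refl ℤ _ ∧ g r.1 = s.1) = 2 := by
  have h := k3Hilbert_natCard_quot_stable_isometryEquiv_of_divisor_mul_totient_of_odd (n := 9) (by norm_num)
    (f := 4) (w := 4) (f₁ := 1) (T₁ := 1) (by norm_num) (by norm_num) (Nat.coprime_one_left 1) odd_one hex
  rw [show Nat.totient 4 = 2 by decide] at h
  simpa using h

/-- **`Kum⁷` (`t = 8`), `div(h) = 4`**: `w = 4`, `f₁ = 1` — exactly `2` orbits under `Õ(Λ_7)` as soon as one exists.
[cite: GritsenkoHulekSankaran2010Symplectic, §4 Prop. 4.6 (i)–(iii) and Remark 4.15] -/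
theorem kumSeven_natCard_quot_stable_isometryEquiv_of_divisor_four {d : ℤ}
    (hex : ∃ h h' : KumIndex → ℤ, Matrix.toBilin' (kumGram 7) h h = 2 * d ∧ h ≠ 0 ∧
      (∀ (k : ℤ) (w : KumIndex → ℤ), k ≠ 0 → k • w ∈ ℤ ∙ h → w ∈ ℤ ∙ h) ∧
      (∀ z, ((4 : ℕ) : ℤ) ∣ Matrix.toBilin' (kumGram 7) h z) ∧ Matrix.toBilin' (kumGram 7) h h' = (4 : ℕ)) :
    Nat.card (Quot fun r s : {r : KumIndex → ℤ // Matrix.toBilin' (kumGram 7) r r = 2 * d ∧ r ≠ 0 ∧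
        (∀ (k : ℤ) (w : KumIndex → ℤ), k ≠ 0 → k • w ∈ ℤ ∙ r → w ∈ ℤ ∙ r) ∧
        (∀ z, ((4 : ℕ) : ℤ) ∣ Matrix.toBilin' (kumGram 7) r z) ∧ ∃ r', Matrix.toBilin' (kumGram 7) r r' = (4 : ℕ)} ↦
      ∃ g : (Matrix.toBilin' (kumGram 7)).IsometryEquiv (Matrix.toBilin' (kumGram 7)),
        g.discriminantGroupCongr = LinearEquiv.refl ℤ _ ∧ g r.1 = s.1) = 2 := by
  have h := kum_natCard_quot_stable_isometryEquiv_of_divisor_mul_totient_of_odd 7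
    (f := 4) (w := 4) (f₁ := 1) (T₁ := 1) (by norm_num) (by norm_num) (Nat.coprime_one_left 1) odd_one hex
  rw [show Nat.totient 4 = 2 by decide] at h
  simpa using h

/-- **`K3^{[10]}` (`t = 9`), `div(h) = 3`**: `w = (3, 18/3) = 3`, `f₁ = 1`, so the primitive `h ∈ Λ_10` with `h² = 2d`,
`(h, Λ_10) = 3ℤ` form exactly `φ(3) · 2^{ρ(1)} = 2` orbits under `Õ(Λ_10)`, as soon as one exists.
[cite: GritsenkoHulekSankaran2010Symplectic, §4 Prop. 4.6 (i)–(iii)] -/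
theorem k3HilbertTen_natCard_quot_stable_isometryEquiv_of_divisor_three {d : ℤ}
    (hex : ∃ h h' : K3HilbertIndex → ℤ, Matrix.toBilin' (k3HilbertGram 10) h h = 2 * d ∧ h ≠ 0 ∧
      (∀ (k : ℤ) (w : K3HilbertIndex → ℤ), k ≠ 0 → k • w ∈ ℤ ∙ h → w ∈ ℤ ∙ h) ∧
      (∀ z, ((3 : ℕ) : ℤ) ∣ Matrix.toBilin' (k3HilbertGram 10) h z) ∧ Matrix.toBilin' (k3HilbertGram 10) h h' = (3 : ℕ)) :
    Nat.card (Quot fun r s : {r : K3HilbertIndex → ℤ // Matrix.toBilin' (k3HilbertGram 10) r r = 2 * d ∧ r ≠ 0 ∧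
        (∀ (k : ℤ) (w : K3HilbertIndex → ℤ), k ≠ 0 → k • w ∈ ℤ ∙ r → w ∈ ℤ ∙ r) ∧
        (∀ z, ((3 : ℕ) : ℤ) ∣ Matrix.toBilin' (k3HilbertGram 10) r z) ∧
        ∃ r', Matrix.toBilin' (k3HilbertGram 10) r r' = (3 : ℕ)} ↦
      ∃ g : (Matrix.toBilin' (k3HilbertGram 10)).IsometryEquiv (Matrix.toBilin' (k3HilbertGram 10)),
        g.discriminantGroupCongr = LinearEquiv.refl ℤ _ ∧ g r.1 = s.1) = 2 := by
  have h := k3Hilbert_natCard_quot_stable_isometryEquiv_of_divisor_mul_totient_of_odd (n := 10) (by norm_num)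
    (f := 3) (w := 3) (f₁ := 1) (T₁ := 2) (by norm_num) (by norm_num) (Nat.coprime_one_left 2) odd_one hex
  rw [show Nat.totient 3 = 2 by decide] at h
  simpa using h

/-- **`Kum⁸` (`t = 9`), `div(h) = 3`**: `w = 3`, `f₁ = 1` — exactly `2` orbits under `Õ(Λ_8)` as soon as one exists.
[cite: GritsenkoHulekSankaran2010Symplectic, §4 Prop. 4.6 (i)–(iii) and Remark 4.15] -/
theorem kumEight_natCard_quot_stable_isometryEquiv_of_divisor_three {d : ℤ}
    (hex : ∃ h h' : KumIndex → ℤ, Matrix.toBilin' (kumGram 8) h h = 2 * d ∧ h ≠ 0 ∧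
      (∀ (k : ℤ) (w : KumIndex → ℤ), k ≠ 0 → k • w ∈ ℤ ∙ h → w ∈ ℤ ∙ h) ∧
      (∀ z, ((3 : ℕ) : ℤ) ∣ Matrix.toBilin' (kumGram 8) h z) ∧ Matrix.toBilin' (kumGram 8) h h' = (3 : ℕ)) :
    Nat.card (Quot fun r s : {r : KumIndex → ℤ // Matrix.toBilin' (kumGram 8) r r = 2 * d ∧ r ≠ 0 ∧
        (∀ (k : ℤ) (w : KumIndex → ℤ), k ≠ 0 → k • w ∈ ℤ ∙ r → w ∈ ℤ ∙ r) ∧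
        (∀ z, ((3 : ℕ) : ℤ) ∣ Matrix.toBilin' (kumGram 8) r z) ∧ ∃ r', Matrix.toBilin' (kumGram 8) r r' = (3 : ℕ)} ↦
      ∃ g : (Matrix.toBilin' (kumGram 8)).IsometryEquiv (Matrix.toBilin' (kumGram 8)),
        g.discriminantGroupCongr = LinearEquiv.refl ℤ _ ∧ g r.1 = s.1) = 2 := by
  have h := kum_natCard_quot_stable_isometryEquiv_of_divisor_mul_totient_of_odd 8
    (f := 3) (w := 3) (f₁ := 1) (T₁ := 2) (by norm_num) (by norm_num) (Nat.coprime_one_left 2) odd_one hex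
  rw [show Nat.totient 3 = 2 by decide] at h
  simpa using h

end Examples

/-! ### §4 Prop. 4.12 (ii) for EVERY divisor in `Λ_n`: `|O(Λ_n, h)/Õ(Λ_n, h)|` in closed form, no `w` hypothesis (row g45-#4) -/

section StabiliserK3Hilbert

variable {n : ℕ}

/-- **Prop. 4.12 (ii) for every odd divisor in the `K3^{[n]}` lattice (`n ≥ 2`, `t = n − 1`)**: for a primitive `h ∈ Λ_n` with
`(h, Λ_n) = fℤ`, `f` odd, the stabiliser `{g ∈ O(Λ_n) : g h = h}` has exactly `2^{#{p ∣ (n−1)/f : p ∤ f}}` distinct actions on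
`A_{Λ_n}` — "of order `2^{ρ(t/f)}` if `f` is odd" when `w = 1` (every prime of `t/f` prime to `f`).
[cite: GritsenkoHulekSankaran2010Symplectic, §4 Prop. 4.12 (ii)] -/
theorem k3Hilbert_natCard_quot_stabiliser_discriminantGroupCongr_eq_two_pow_filter_of_odd (hn : 2 ≤ n)
    {h h' : K3HilbertIndex → ℤ} {f : ℕ} (hfo : Odd f) (hh0 : h ≠ 0)
    (hsat : ∀ (k : ℤ) (w : K3HilbertIndex → ℤ), k ≠ 0 → k • w ∈ ℤ ∙ h → w ∈ ℤ ∙ h)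
    (hfh : ∀ z, (f : ℤ) ∣ Matrix.toBilin' (k3HilbertGram n) h z) (hh' : Matrix.toBilin' (k3HilbertGram n) h h' = f) :
    Nat.card (Quot fun g g' : {g : (Matrix.toBilin' (k3HilbertGram n)).IsometryEquiv (Matrix.toBilin' (k3HilbertGram n)) //
        g h = h} ↦ g.1.discriminantGroupCongr = g'.1.discriminantGroupCongr) = 2 ^ (((n - 1) / f).primeFactors.filter fun p ↦ ¬p ∣ f).card := by
  have hf0 : (f : ℤ) ≠ 0 := by exact_mod_cast hfo.pos.ne'
  rw [k3Hilbert_natCard_quot_stabiliser_discriminantGroupCongr_eq hn hf0 hh0 hsat hfh hh']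
  exact natCard_sf_eq_two_pow_filter_of_odd (by omega) hfo (k3Hilbert_dvd_two_mul_of_forall_dvd_of_primitive hn hh0 hsat hfh)

/-- **Prop. 4.12 (ii) for every even divisor `f = 2m` in the `K3^{[n]}` lattice (`n ≥ 2`, `t = n − 1`)**: the stabiliser of a
primitive `h ∈ Λ_n` with `(h, Λ_n) = 2mℤ` has exactly `2^{#{p ∣ (n−1)/m : p ∤ m}}` distinct actions on `A_{Λ_n}`
(`(n−1)/m = 2t/f`; "`2^{ρ(2t/f)+δ}`" with `δ = 0` when `w = 1`). [cite: GritsenkoHulekSankaran2010Symplectic, §4 Prop. 4.12 (ii)] -/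
theorem k3Hilbert_natCard_quot_stabiliser_discriminantGroupCongr_eq_two_pow_filter_of_even (hn : 2 ≤ n)
    {h h' : K3HilbertIndex → ℤ} {m : ℕ} (hm : 0 < m) (hh0 : h ≠ 0)
    (hsat : ∀ (k : ℤ) (w : K3HilbertIndex → ℤ), k ≠ 0 → k • w ∈ ℤ ∙ h → w ∈ ℤ ∙ h)
    (hfh : ∀ z, (2 * m : ℤ) ∣ Matrix.toBilin' (k3HilbertGram n) h z)
    (hh' : Matrix.toBilin' (k3HilbertGram n) h h' = 2 * m) :
    Nat.card (Quot fun g g' : {g : (Matrix.toBilin' (k3HilbertGram n)).IsometryEquiv (Matrix.toBilin' (k3HilbertGram n)) //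
        g h = h} ↦ g.1.discriminantGroupCongr = g'.1.discriminantGroupCongr) = 2 ^ (((n - 1) / m).primeFactors.filter fun p ↦ ¬p ∣ m).card := by
  have hf0 : (2 * m : ℤ) ≠ 0 := by positivity
  rw [k3Hilbert_natCard_quot_stabiliser_discriminantGroupCongr_eq hn hf0 hh0 hsat hfh hh']
  exact natCard_sf_eq_two_pow_filter_of_even (by omega) hm (k3Hilbert_dvd_two_mul_of_forall_dvd_of_primitive hn hh0 hsat hfh)

/-- **`K3^{[9]}` (`t = 8`), `div(h) = 2`** (`(f, 2t/f) = 2`, outside `w = 1`): the stabiliser of `h` has exactly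
`2^{#{p ∣ 8 : p ∤ 1}} = 2` distinct actions on `A_{Λ_9} ≅ ℤ/16`. [cite: GritsenkoHulekSankaran2010Symplectic, §4 Prop. 4.12 (ii) and proof (the set `O(⟨k̄₃⟩)`)] -/
theorem k3HilbertNine_natCard_quot_stabiliser_discriminantGroupCongr_of_divisor_two {h h' : K3HilbertIndex → ℤ}
    (hh0 : h ≠ 0) (hsat : ∀ (k : ℤ) (w : K3HilbertIndex → ℤ), k ≠ 0 → k • w ∈ ℤ ∙ h → w ∈ ℤ ∙ h)
    (hfh : ∀ z, (2 * (1 : ℕ) : ℤ) ∣ Matrix.toBilin' (k3HilbertGram 9) h z)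
    (hh' : Matrix.toBilin' (k3HilbertGram 9) h h' = 2 * (1 : ℕ)) :
    Nat.card (Quot fun g g' : {g : (Matrix.toBilin' (k3HilbertGram 9)).IsometryEquiv (Matrix.toBilin' (k3HilbertGram 9)) //
        g h = h} ↦ g.1.discriminantGroupCongr = g'.1.discriminantGroupCongr) = 2 := by
  rw [k3Hilbert_natCard_quot_stabiliser_discriminantGroupCongr_eq_two_pow_filter_of_even (n := 9) (by norm_num) one_pos
    hh0 hsat hfh hh', show (9 - 1) / 1 = 2 ^ 3 by norm_num, Nat.primeFactors_prime_pow three_ne_zero Nat.prime_two,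
    Finset.filter_singleton, if_pos (by norm_num), Finset.card_singleton, pow_one]

/-- **`K3^{[9]}` (`t = 8`), `div(h) = 4`** (`(f, 2t/f) = 4`): the stabiliser of `h` acts on `A_{Λ_9}` through a SINGLE class
(`2^{#{p ∣ 4 : p ∤ 2}} = 1`), i.e. `O(Λ_9, h)` and `Õ(Λ_9, h)` have the same image.
[cite: GritsenkoHulekSankaran2010Symplectic, §4 Prop. 4.12 (ii) and proof (the set `O(⟨k̄₃⟩)`)] -/
theorem k3HilbertNine_natCard_quot_stabiliser_discriminantGroupCongr_of_divisor_four {h h' : K3HilbertIndex → ℤ}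
    (hh0 : h ≠ 0) (hsat : ∀ (k : ℤ) (w : K3HilbertIndex → ℤ), k ≠ 0 → k • w ∈ ℤ ∙ h → w ∈ ℤ ∙ h)
    (hfh : ∀ z, (2 * (2 : ℕ) : ℤ) ∣ Matrix.toBilin' (k3HilbertGram 9) h z)
    (hh' : Matrix.toBilin' (k3HilbertGram 9) h h' = 2 * (2 : ℕ)) :
    Nat.card (Quot fun g g' : {g : (Matrix.toBilin' (k3HilbertGram 9)).IsometryEquiv (Matrix.toBilin' (k3HilbertGram 9)) //
        g h = h} ↦ g.1.discriminantGroupCongr = g'.1.discriminantGroupCongr) = 1 := by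
  rw [k3Hilbert_natCard_quot_stabiliser_discriminantGroupCongr_eq_two_pow_filter_of_even (n := 9) (by norm_num) two_pos
    hh0 hsat hfh hh', show (9 - 1) / 2 = 2 ^ 2 by norm_num, Nat.primeFactors_prime_pow two_ne_zero Nat.prime_two,
    Finset.filter_singleton, if_neg (by norm_num), Finset.card_empty, pow_zero]

end StabiliserK3Hilbert

section StabiliserKum

variable {n : ℕ}

/-- **Prop. 4.12 (ii) for every odd divisor in the `Kumⁿ` lattice (`t = n + 1`; Remark 4.15)**: the stabiliser of a primitive
`h ∈ Λ_n` with `(h, Λ_n) = fℤ`, `f` odd, has exactly `2^{#{p ∣ (n+1)/f : p ∤ f}}` distinct actions on `A_{Λ_n}`.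
[cite: GritsenkoHulekSankaran2010Symplectic, §4 Prop. 4.12 (ii) and Remark 4.15] -/
theorem kum_natCard_quot_stabiliser_discriminantGroupCongr_eq_two_pow_filter_of_odd (n : ℕ) {h h' : KumIndex → ℤ}
    {f : ℕ} (hfo : Odd f) (hh0 : h ≠ 0) (hsat : ∀ (k : ℤ) (w : KumIndex → ℤ), k ≠ 0 → k • w ∈ ℤ ∙ h → w ∈ ℤ ∙ h)
    (hfh : ∀ z, (f : ℤ) ∣ Matrix.toBilin' (kumGram n) h z) (hh' : Matrix.toBilin' (kumGram n) h h' = f) :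
    Nat.card (Quot fun g g' : {g : (Matrix.toBilin' (kumGram n)).IsometryEquiv (Matrix.toBilin' (kumGram n)) //
        g h = h} ↦ g.1.discriminantGroupCongr = g'.1.discriminantGroupCongr) = 2 ^ (((n + 1) / f).primeFactors.filter fun p ↦ ¬p ∣ f).card := by
  have hf0 : (f : ℤ) ≠ 0 := by exact_mod_cast hfo.pos.ne'
  rw [kum_natCard_quot_stabiliser_discriminantGroupCongr_eq n hf0 hh0 hsat hfh hh']
  exact natCard_sf_eq_two_pow_filter_of_odd (Nat.succ_pos n) hfo (kum_dvd_two_mul_of_forall_dvd_of_primitive hh0 hsat hfh)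

/-- **Prop. 4.12 (ii) for every even divisor `f = 2m` in the `Kumⁿ` lattice (`t = n + 1`)**: `2^{#{p ∣ (n+1)/m : p ∤ m}}`
distinct actions of the stabiliser on `A_{Λ_n}`. [cite: GritsenkoHulekSankaran2010Symplectic, §4 Prop. 4.12 (ii) and Remark 4.15] -/
theorem kum_natCard_quot_stabiliser_discriminantGroupCongr_eq_two_pow_filter_of_even (n : ℕ) {h h' : KumIndex → ℤ}
    {m : ℕ} (hm : 0 < m) (hh0 : h ≠ 0) (hsat : ∀ (k : ℤ) (w : KumIndex → ℤ), k ≠ 0 → k • w ∈ ℤ ∙ h → w ∈ ℤ ∙ h)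
    (hfh : ∀ z, (2 * m : ℤ) ∣ Matrix.toBilin' (kumGram n) h z) (hh' : Matrix.toBilin' (kumGram n) h h' = 2 * m) :
    Nat.card (Quot fun g g' : {g : (Matrix.toBilin' (kumGram n)).IsometryEquiv (Matrix.toBilin' (kumGram n)) //
        g h = h} ↦ g.1.discriminantGroupCongr = g'.1.discriminantGroupCongr) = 2 ^ (((n + 1) / m).primeFactors.filter fun p ↦ ¬p ∣ m).card := by
  have hf0 : (2 * m : ℤ) ≠ 0 := by positivity
  rw [kum_natCard_quot_stabiliser_discriminantGroupCongr_eq n hf0 hh0 hsat hfh hh']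
  exact natCard_sf_eq_two_pow_filter_of_even (Nat.succ_pos n) hm (kum_dvd_two_mul_of_forall_dvd_of_primitive hh0 hsat hfh)

/-- **`Kum⁷` (`t = 8`), `div(h) = 2`**: two distinct actions of the stabiliser on `A_{Λ_7} ≅ ℤ/16`.
[cite: GritsenkoHulekSankaran2010Symplectic, §4 Prop. 4.12 (ii) and Remark 4.15] -/
theorem kumSeven_natCard_quot_stabiliser_discriminantGroupCongr_of_divisor_two {h h' : KumIndex → ℤ}
    (hh0 : h ≠ 0) (hsat : ∀ (k : ℤ) (w : KumIndex → ℤ), k ≠ 0 → k • w ∈ ℤ ∙ h → w ∈ ℤ ∙ h)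
    (hfh : ∀ z, (2 * (1 : ℕ) : ℤ) ∣ Matrix.toBilin' (kumGram 7) h z) (hh' : Matrix.toBilin' (kumGram 7) h h' = 2 * (1 : ℕ)) :
    Nat.card (Quot fun g g' : {g : (Matrix.toBilin' (kumGram 7)).IsometryEquiv (Matrix.toBilin' (kumGram 7)) //
        g h = h} ↦ g.1.discriminantGroupCongr = g'.1.discriminantGroupCongr) = 2 := by
  rw [kum_natCard_quot_stabiliser_discriminantGroupCongr_eq_two_pow_filter_of_even 7 one_pos hh0 hsat hfh hh',
    show (7 + 1) / 1 = 2 ^ 3 by norm_num, Nat.primeFactors_prime_pow three_ne_zero Nat.prime_two, Finset.filter_singleton,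
    if_pos (by norm_num), Finset.card_singleton, pow_one]

/-- **`Kum⁷` (`t = 8`), `div(h) = 4`**: a single action of the stabiliser on `A_{Λ_7}`.
[cite: GritsenkoHulekSankaran2010Symplectic, §4 Prop. 4.12 (ii) and Remark 4.15] -/
theorem kumSeven_natCard_quot_stabiliser_discriminantGroupCongr_of_divisor_four {h h' : KumIndex → ℤ}
    (hh0 : h ≠ 0) (hsat : ∀ (k : ℤ) (w : KumIndex → ℤ), k ≠ 0 → k • w ∈ ℤ ∙ h → w ∈ ℤ ∙ h)
    (hfh : ∀ z, (2 * (2 : ℕ) : ℤ) ∣ Matrix.toBilin' (kumGram 7) h z) (hh' : Matrix.toBilin' (kumGram 7) h h' = 2 * (2 : ℕ)) :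
    Nat.card (Quot fun g g' : {g : (Matrix.toBilin' (kumGram 7)).IsometryEquiv (Matrix.toBilin' (kumGram 7)) //
        g h = h} ↦ g.1.discriminantGroupCongr = g'.1.discriminantGroupCongr) = 1 := by
  rw [kum_natCard_quot_stabiliser_discriminantGroupCongr_eq_two_pow_filter_of_even 7 two_pos hh0 hsat hfh hh',
    show (7 + 1) / 2 = 2 ^ 2 by norm_num, Nat.primeFactors_prime_pow two_ne_zero Nat.prime_two, Finset.filter_singleton,
    if_neg (by norm_num), Finset.card_empty, pow_zero]

end StabiliserKum

end Literature.AlgebraicGeometry.Hyperkaehler
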